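import Literature.NumberTheory.EllipticCurves.SerreOpenImageTameKummerProofs
import Literature.NumberTheory.EllipticCurves.KummerUnramifiedConverse
import Literature.NumberTheory.GaloisRepresentations.HeckeCharacterProofs
import Literature.NumberTheory.GaloisRepresentations.GaloisCohomologyKummerProofs
import Literature.NumberTheory.GaloisRepresentations.DecompositionGroupOfCompletion
import Literature.NumberTheory.EllipticCurves.GreenbergSelmer
import Mathlib.NumberTheory.Padics.HeightOneSpectrum
import HarnessLib

/-!
# Route `EisensteinPrimes`, crux 2 `GoodLatticeBDPValue` (stmt-BirchSwinnertonDyer-19032), line `halves`, AN-3 Stub B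
# (`FullDescentAtThreeOfRed`), global input F5 (Kummer splitting lemma), ARITHMETIC HALF: **a rational number `a` with a
# cube root `α ∈ ℚ̄` fixed by one inertia group above every prime `p ≠ 3` and by the decomposition group at `3` is a
# rational cube**

Cell `bsd-eis` (home `run/shared/lean/pub/bsd-eis/`), width seat `bsd-line-x1-p1-w2` (gen 5; `--supports -19032`, closes
nothing by itself). The elementary `E[9]` proof of Theorem T′ (AN-3 Stub B, idea-11 g9
`Cruxes/GoodLatticeBDPValue/Lines/halves_anThree_typedSplit_idea11g9.lean` §3; road memo
`HOME/line-x1-p1-w3-g4/AN3-StubB-elementary-road.md` F5) twice splits an extension `0 → 𝟙 → X → μ₃ → 0` of `Γ_ℚ`-modules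
that is inertia-trivial away from `3` and `D₃`-split. The splitting class is a `μ₃`-valued 1-cocycle of `Γ_ℚ`, hence
(tree, cocycle-level Kummer theory over ANY field with `3` invertible — no `μ₃ ⊆ ℚ` needed:
`absoluteGaloisGroup.exists_kummer_eq_of_isLocallyConstant_cocycle`) the Kummer cocycle `σ ↦ σα/α` of a cube root `α` of
some `a ∈ ℚˣ`; the local hypotheses become «`I_𝔓` fixes `α`» (`p ≠ 3`) and «`D₃` fixes `α`», and this file turns them
into «`a` is a cube in `ℚ`» (so the cocycle is the coboundary of `α/∛a ∈ μ₃`, and `X` splits — sibling file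
`…FullDescentKummerSplitting`). No class field theory of `ℚ(ζ₃)` and no named fact is used:

* `three_dvd_padicValInt_of_forall_inertia_smul_eq` / `three_dvd_padicValRat_of_forall_inertia_smul_eq` — `p ≠ 3`
  prime, `𝔓 ∣ p` a prime of `\bar ℤ`, `β³ = c ∈ ℤ ∖ 0` (resp. `α³ = a ∈ ℚˣ`), `I_𝔓` fixes the root ⟹ `3 ∣ ord_p`. Proof:
  if `c = p^k c'`, `p ∤ c'`, `k = 3q + r`, `r ∈ {1, 2}`, then `γ = β/(p^q π^r)` (`π³ = p`) has `γ³ = c'`, so `I_𝔓` fixes `γ`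
  (Lang FDG 6.1.3 "if", the tree's `absoluteGaloisGroup_inertia_fixes_root_of_not_mem`) but moves `π` by a primitive cube
  root of unity (Serre 1972 §1.3, the tree's `exists_mem_inertia_smul_eq_mul_of_pow_eq`), contradiction.
* `three_dvd_padicValRat_three_of_forall_decomp_smul_eq` — `α³ = a ∈ ℚˣ` and the decomposition group
  `GreenbergSelmer.decomp v₃` (image of `Γ_{ℚ₃}`) fixes `α` ⟹ `3 ∣ v₃(a)`: along the chosen embedding `ℚ̄ → ℚ̄₃`
  (`absGaloisRestrict_apply_smul`) the image of `α` is `Γ_{ℚ₃}`-fixed, hence in `ℚ₃`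
  (`absoluteGaloisGroup.exists_algebraMap_eq_pow_of_forall_smul_eq`), so `a ∈ ℚ₃׳` and `v₃(a) ∈ 3ℤ`.
* `exists_pow_three_eq_of_forall_dvd_padicValRat` — `a ∈ ℚˣ` with `3 ∣ v_p(a)` for every prime `p` is a cube
  (`ℚ` has class number one: factor numerator and denominator).
* **`exists_pow_three_eq_of_forall_inertia_of_decomp`** — the assembly: `α³ = a ∈ ℚˣ`, `α` fixed by one inertia group
  above every `p ≠ 3` and by `D₃` ⟹ `a ∈ ℚ׳`.
* `valuation_ringOfIntegers_eq_exp_neg_padicValRat` — the bridge `v(x) = exp(−ord_p x)` between the adic valuation at a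
  place `v` of `𝓞 ℚ` and `padicValRat` (Mathlib proves the two valuations equivalent,
  `Rat.HeightOneSpectrum.valuation_equiv_padicValuation`; copy of the tree's bridge for `HeightOneSpectrum ℤ`).

HONEST FRAMING: helper theorems only (0 definitions, 0 named facts, 0 sorry); no summit statement, no BSD / IMC2 /
Keller–Yin theorem, no stub of the registered skeleton is proved here. References: [SilvermanAEC2009] VIII.1.6 (proof),
VIII §2; [Lang1983] Ch. 6 Prop. 1.3; [Serre1972] §1.3 Prop. 1–2; [SerreLocalFields1979] Ch. X §3 b).
-/

set_option autoImplicit false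
-- the route's Theorems namespace repeats the summit name by design (D-0017 nested layout)
set_option linter.dupNamespace false

noncomputable section

open scoped Classical NumberField

namespace Summit.BirchSwinnertonDyer.BirchSwinnertonDyer.Theorems.FullDescentKummerArithmetic

open Function NumberField IsDedekindDomain Field Rat.HeightOneSpectrum WithZero
  Literature.NumberTheory.GaloisRepresentations Literature.NumberTheory.EllipticCurves

/-! ## §1. The bridge `v(x) = exp(−ord_p x)` for places of `𝓞 ℚ` -/

/-- **The `v`-adic valuation of `ℚ` is the `p`-adic one**, `p = natGenerator v`: `v(x) = exp(−ord_p x)` for `x ≠ 0`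
(Mathlib's `valuation_equiv_padicValuation` says the two valuations are equivalent; both send `p` to `exp(−1)`).
[folklore] -/
theorem valuation_ringOfIntegers_eq_exp_neg_padicValRat (v : HeightOneSpectrum (𝓞 ℚ)) {x : ℚ} (hx : x ≠ 0) :
    v.valuation ℚ x = exp (-padicValRat (natGenerator v) x) := by
  haveI hp : Fact (natGenerator v).Prime := ⟨prime_natGenerator v⟩
  haveI hp' : Fact (Nat.Prime ((primesEquiv v : Nat.Primes) : ℕ)) := ⟨(primesEquiv v).2⟩
  have hequiv := valuation_equiv_padicValuation v
  set n : ℤ := padicValRat (natGenerator v) x with hn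
  have h2x : Rat.padicValuation (primesEquiv v) x = exp (-n) := by
    change Rat.padicValuation (natGenerator v) x = _
    simp [Rat.padicValuation, hx, hn]
  have h2p : Rat.padicValuation (primesEquiv v) ((natGenerator v : ℚ) ^ n) = exp (-n) := by
    change Rat.padicValuation (natGenerator v) _ = _
    rw [map_zpow₀, Rat.padicValuation_self, ← exp_zsmul]
    simp
  have h1p : v.valuation ℚ ((natGenerator v : ℚ) ^ n) = exp (-n) := by
    rw [map_zpow₀, Rat.valuation_natGenerator, ← exp_zsmul]
    simp
  rw [← h1p]
  exact (hequiv.eq_iff).mpr (h2x.trans h2p.symm)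

/-! ## §2. A rational number all of whose valuations are divisible by `3` is a cube -/

/-- A natural number whose prime exponents are all divisible by `3` is a cube. [folklore] -/
theorem nat_exists_pow_three_eq_of_forall_dvd {n : ℕ} (hn : n ≠ 0) (h : ∀ p : ℕ, p.Prime → 3 ∣ padicValNat p n) :
    ∃ m : ℕ, m ^ 3 = n := by
  refine ⟨n.factorization.prod fun p e ↦ p ^ (e / 3), ?_⟩
  conv_rhs => rw [← Nat.prod_factorization_pow_eq_self hn]
  rw [Finsupp.prod, Finsupp.prod, ← Finset.prod_pow]
  refine Finset.prod_congr rfl fun p hp ↦ ?_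
  rw [← pow_mul]
  congr 1
  have hpp : p.Prime := Nat.prime_of_mem_primeFactors (Nat.support_factorization n ▸ hp)
  have h3 : 3 ∣ n.factorization p := by
    rw [Nat.factorization_def n hpp]
    exact h p hpp
  exact Nat.div_mul_cancel h3

/-- **`a ∈ ℚˣ` with `3 ∣ ord_p(a)` for every prime `p` is a cube in `ℚ`** (`ℚ` has class number one: `a = ± N/D` with
`N, D` coprime naturals, each prime exponent of `N` and of `D` is divisible by `3`, and `−1 = (−1)³`). [folklore] -/
theorem exists_pow_three_eq_of_forall_dvd_padicValRat {a : ℚ} (ha : a ≠ 0)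
    (h : ∀ p : ℕ, p.Prime → (3 : ℤ) ∣ padicValRat p a) : ∃ r : ℚ, r ^ 3 = a := by
  have hnum : a.num ≠ 0 := Rat.num_ne_zero.mpr ha
  have hN0 : a.num.natAbs ≠ 0 := Int.natAbs_ne_zero.mpr hnum
  have hD0 : a.den ≠ 0 := a.den_nz
  -- at each prime, at most one of `num`, `den` is divisible by `p`, so both exponents are divisible by `3`
  have hsplit : ∀ p : ℕ, p.Prime → 3 ∣ padicValNat p a.num.natAbs ∧ 3 ∣ padicValNat p a.den := by
    intro p hp
    haveI : Fact p.Prime := ⟨hp⟩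
    have hv : padicValRat p a = (padicValInt p a.num : ℤ) - (padicValNat p a.den : ℤ) := rfl
    have hcop : Nat.Coprime a.num.natAbs a.den := a.reduced
    have h3 := h p hp
    rw [hv, padicValInt] at h3
    by_cases hpn : p ∣ a.num.natAbs
    · have hpd : ¬ p ∣ a.den := fun hpd ↦ hp.one_lt.ne' (Nat.eq_one_of_dvd_coprimes hcop hpn hpd)
      have hd0 : padicValNat p a.den = 0 := padicValNat.eq_zero_of_not_dvd hpd
      rw [hd0, Nat.cast_zero, sub_zero] at h3
      exact ⟨by exact_mod_cast h3, by rw [hd0]; exact dvd_zero 3⟩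
    · have hn0 : padicValNat p a.num.natAbs = 0 := padicValNat.eq_zero_of_not_dvd hpn
      rw [hn0, Nat.cast_zero, zero_sub, dvd_neg] at h3
      exact ⟨by rw [hn0]; exact dvd_zero 3, by exact_mod_cast h3⟩
  obtain ⟨m, hm⟩ := nat_exists_pow_three_eq_of_forall_dvd hN0 fun p hp ↦ (hsplit p hp).1
  obtain ⟨d, hd⟩ := nat_exists_pow_three_eq_of_forall_dvd hD0 fun p hp ↦ (hsplit p hp).2
  have hdenq : (a.den : ℚ) = (d : ℚ) ^ 3 := by rw [← hd]; push_cast; ring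
  rcases Int.natAbs_eq a.num with hs | hs
  · refine ⟨(m : ℚ) / d, ?_⟩
    have hnumq : (a.num : ℚ) = (m : ℚ) ^ 3 := by rw [hs, ← hm]; push_cast; ring
    rw [div_pow, ← hnumq, ← hdenq]
    exact Rat.num_div_den a
  · refine ⟨-(m : ℚ) / d, ?_⟩
    have hnumq : (a.num : ℚ) = (-(m : ℚ)) ^ 3 := by rw [hs, ← hm]; push_cast; ring
    rw [div_pow, ← hnumq, ← hdenq]
    exact Rat.num_div_den a

/-! ## §3. At `p ≠ 3`: an inertia group fixing a cube root of `a` forces `3 ∣ ord_p(a)` -/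

/-- **Unramified cube roots away from `3`, integral form.** Let `p ≠ 3` be a prime, `v` the place of `ℚ` at `p`, `𝔓 ∣ v`
a prime of `\bar ℤ`, `c ∈ ℤ ∖ {0}` and `β ∈ ℚ̄` with `β³ = c`. If every element of the inertia group `I_𝔓 ≤ Γ_ℚ` fixes
`β`, then `3 ∣ ord_p(c)` (Silverman VIII.1.6: `ℚ_p(c^{1/3})/ℚ_p` unramified iff `ord_p(c) ≡ 0 (mod 3)`, `p ∤ 3` — "only
if"). Proof without local fields: write `c = p^k c'` with `p ∤ c'`, `k = 3q + r`; if `r ∈ {1, 2}` then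
`γ := β / (p^q π^r)` (`π³ = p`) has `γ³ = c'`, so `I_𝔓` fixes `γ` (Lang FDG 6.1.3 "if", the tree's
`absoluteGaloisGroup_inertia_fixes_root_of_not_mem`), hence fixes `π^r`; but some `s ∈ I_𝔓` has `s π = ζ π` with `ζ` a
primitive cube root of unity (Serre 1972 §1.3, the tree's `exists_mem_inertia_smul_eq_mul_of_pow_eq`), and `ζ^r ≠ 1`.
[cite: SilvermanAEC2009, Prop. VIII.1.6 (proof)] [cite: Serre1972, §1.3 Prop. 1–2] -/
theorem three_dvd_padicValInt_of_forall_inertia_smul_eq {p : ℕ} (hp : p.Prime) (hp3 : p ≠ 3)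
    {v : HeightOneSpectrum (𝓞 ℚ)} (hv : natGenerator v = p)
    {𝔓 : Ideal (absIntegers (𝓞 ℚ) ℚ)} (h𝔓 : 𝔓 ∈ v.primesAbove)
    {c : ℤ} (hc : c ≠ 0) {β : AlgebraicClosure ℚ} (hβ : β ^ 3 = (c : AlgebraicClosure ℚ))
    (hI : ∀ τ ∈ 𝔓.inertia (absoluteGaloisGroup ℚ), τ • β = β) :
    3 ∣ padicValInt p c := by
  haveI : Fact p.Prime := ⟨hp⟩
  by_contra h3
  -- `c = p^k c'` with `p ∤ c'`, `k = 3q + r`, `r ∈ {1, 2}`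
  set k : ℕ := padicValInt p c with hk
  obtain ⟨c', hcc'⟩ := padicValInt_dvd (p := p) c
  rw [← hk] at hcc'
  have hc'0 : c' ≠ 0 := fun h ↦ hc (by rw [hcc', h, mul_zero])
  have hpc' : ¬ (p : ℤ) ∣ c' := by
    rintro ⟨c'', rfl⟩
    have h1 : (p : ℤ) ^ (k + 1) ∣ c := ⟨c'', by rw [hcc']; ring⟩
    rcases (padicValInt_dvd_iff (k + 1) c).mp h1 with h | h
    · exact hc h
    · rw [← hk] at h; omega
  set q : ℕ := k / 3 with hq
  set r : ℕ := k % 3 with hr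
  have hkqr : k = 3 * q + r := by omega
  have hr12 : r = 1 ∨ r = 2 := by omega
  -- a cube root `π` of `p` and a primitive cube root of unity `ζ`
  obtain ⟨π, hπ⟩ := IsAlgClosed.exists_pow_nat_eq ((p : ℕ) : AlgebraicClosure ℚ) (by norm_num : 0 < 3)
  obtain ⟨ζ, hζ⟩ := HasEnoughRootsOfUnity.exists_primitiveRoot (AlgebraicClosure ℚ) 3
  have hp0 : ((p : ℕ) : AlgebraicClosure ℚ) ≠ 0 := Nat.cast_ne_zero.mpr hp.ne_zero
  have hπ0 : π ≠ 0 := by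
    intro h
    rw [h, zero_pow (by norm_num)] at hπ
    exact hp0 hπ.symm
  -- `γ := β / (p^q π^r)`, `γ³ = c'`
  set γ : AlgebraicClosure ℚ := β * (((p : ℕ) : AlgebraicClosure ℚ) ^ q * π ^ r)⁻¹ with hγ
  have hden0 : ((p : ℕ) : AlgebraicClosure ℚ) ^ q * π ^ r ≠ 0 := mul_ne_zero (pow_ne_zero _ hp0) (pow_ne_zero _ hπ0)
  have hγ3 : γ ^ 3 = (c' : AlgebraicClosure ℚ) := by
    have h1 : (((p : ℕ) : AlgebraicClosure ℚ) ^ q * π ^ r) ^ 3 = ((p : ℕ) : AlgebraicClosure ℚ) ^ k := by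
      rw [mul_pow, ← pow_mul, ← pow_mul, mul_comm r 3, pow_mul π 3 r, hπ, ← pow_add, mul_comm q 3, hkqr]
    have h2 : (c : AlgebraicClosure ℚ) = ((p : ℕ) : AlgebraicClosure ℚ) ^ k * (c' : AlgebraicClosure ℚ) := by
      rw [hcc']; push_cast; ring
    rw [hγ, mul_pow, inv_pow, h1, hβ, h2, mul_comm (((p : ℕ) : AlgebraicClosure ℚ) ^ k),
      mul_assoc, mul_inv_cancel₀ (pow_ne_zero _ hp0), mul_one]
  -- `I_𝔓` fixes `γ`
  have hc'O : ((c' : 𝓞 ℚ) : 𝓞 ℚ) ∉ v.asIdeal := by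
    rw [Rat.intCast_mem_asIdeal_iff, hv]
    exact hpc'
  have h3O : ((3 : ℕ) : 𝓞 ℚ) ∉ v.asIdeal := by
    rw [Rat.natCast_mem_asIdeal_iff, hv, Nat.prime_dvd_prime_iff_eq hp Nat.prime_three]
    exact hp3
  have hγ3' : γ ^ 3 = algebraMap (𝓞 ℚ) (AlgebraicClosure ℚ) (c' : 𝓞 ℚ) := by
    rw [map_intCast]; exact hγ3
  have hIγ : ∀ τ ∈ 𝔓.inertia (absoluteGaloisGroup ℚ), τ • γ = γ := fun τ hτ ↦
    absoluteGaloisGroup_inertia_fixes_root_of_not_mem v hc'O h3O hγ3' h𝔓 hτ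
  -- hence fixes `π ^ r`
  have hpfix : ∀ τ : absoluteGaloisGroup ℚ, τ • ((p : ℕ) : AlgebraicClosure ℚ) = p := fun τ ↦ by
    rw [absoluteGaloisGroup.smul_def, map_natCast]
  have hβ0 : β ≠ 0 := by
    intro h
    rw [h, zero_pow (by norm_num), eq_comm, Int.cast_eq_zero] at hβ
    exact hc hβ
  have hfix : ∀ τ ∈ 𝔓.inertia (absoluteGaloisGroup ℚ), (τ • π) ^ r = π ^ r := by
    intro τ hτ
    have h1 := hIγ τ hτ
    rw [hγ, smul_mul', hI τ hτ, smul_inv'', smul_mul', smul_pow', smul_pow', hpfix] at h1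
    have h2 := mul_left_cancel₀ hβ0 h1
    have h3' := inv_injective h2
    exact mul_left_cancel₀ (pow_ne_zero _ hp0) h3'
  -- but some `s ∈ I_𝔓` moves `π` by the primitive cube root of unity `ζ`
  have hv' : (primesEquiv v : ℕ) = p := hv
  obtain ⟨s, hsI, hs⟩ :=
    exists_mem_inertia_smul_eq_mul_of_pow_eq p (by norm_num : 0 < 3) hv' h𝔓 hπ hζ.pow_eq_one
  have h4 := hfix s hsI
  rw [hs, mul_pow] at h4
  have h5 : ζ ^ r = 1 := (mul_left_eq_self₀.mp h4).resolve_right (pow_ne_zero _ hπ0)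
  have h6 := hζ.dvd_of_pow_eq_one _ h5
  rcases hr12 with h | h <;> rw [h] at h6 <;> omega

/-- **Unramified cube roots away from `3`, rational form**: `p ≠ 3` prime, `𝔓 ∣ p` a prime of `\bar ℤ`, `a ∈ ℚˣ` and
`α ∈ ℚ̄` with `α³ = a`; if `I_𝔓` fixes `α` then `3 ∣ ord_p(a)` (apply the integral form to `β = α · den(a)`,
`β³ = num(a) den(a)²`). [cite: SilvermanAEC2009, Prop. VIII.1.6 (proof)] [cite: Serre1972, §1.3 Prop. 1–2] -/
theorem three_dvd_padicValRat_of_forall_inertia_smul_eq {p : ℕ} (hp : p.Prime) (hp3 : p ≠ 3)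
    {v : HeightOneSpectrum (𝓞 ℚ)} (hv : natGenerator v = p)
    {𝔓 : Ideal (absIntegers (𝓞 ℚ) ℚ)} (h𝔓 : 𝔓 ∈ v.primesAbove)
    {a : ℚ} (ha : a ≠ 0) {α : AlgebraicClosure ℚ} (hα : α ^ 3 = (a : AlgebraicClosure ℚ))
    (hI : ∀ τ ∈ 𝔓.inertia (absoluteGaloisGroup ℚ), τ • α = α) :
    (3 : ℤ) ∣ padicValRat p a := by
  haveI : Fact p.Prime := ⟨hp⟩
  have hnum : a.num ≠ 0 := Rat.num_ne_zero.mpr ha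
  have hden : (a.den : ℤ) ≠ 0 := Int.natCast_ne_zero.mpr a.den_nz
  set c : ℤ := a.num * (a.den : ℤ) ^ 2 with hc
  have hc0 : c ≠ 0 := mul_ne_zero hnum (pow_ne_zero _ hden)
  set β : AlgebraicClosure ℚ := α * ((a.den : ℕ) : AlgebraicClosure ℚ) with hβ
  have hβ3 : β ^ 3 = (c : AlgebraicClosure ℚ) := by
    have hden' : ((a.den : ℕ) : AlgebraicClosure ℚ) ≠ 0 := Nat.cast_ne_zero.mpr a.den_nz
    rw [hβ, mul_pow, hα, hc, Rat.cast_def]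
    push_cast
    field_simp
  have hIβ : ∀ τ ∈ 𝔓.inertia (absoluteGaloisGroup ℚ), τ • β = β := fun τ hτ ↦ by
    rw [hβ, smul_mul', hI τ hτ, absoluteGaloisGroup.smul_def τ ((a.den : ℕ) : AlgebraicClosure ℚ), map_natCast]
  have h3 := three_dvd_padicValInt_of_forall_inertia_smul_eq hp hp3 hv h𝔓 hc0 hβ3 hIβ
  -- `ord_p(c) = ord_p(num) + 2 ord_p(den)` and `ord_p(a) = ord_p(num) − ord_p(den)`
  have hv1 : padicValInt p c = padicValInt p a.num + 2 * padicValNat p a.den := by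
    rw [hc, padicValInt.mul hnum (pow_ne_zero _ hden), pow_two, padicValInt.mul hden hden, padicValInt.of_nat]
    ring
  have hv2 : padicValRat p a = (padicValInt p a.num : ℤ) - (padicValNat p a.den : ℤ) := rfl
  rw [hv2]
  rw [hv1] at h3
  have h3' : (3 : ℤ) ∣ ((padicValInt p a.num : ℤ) + 2 * (padicValNat p a.den : ℤ)) := by exact_mod_cast h3
  have : (padicValInt p a.num : ℤ) - (padicValNat p a.den : ℤ) =
      ((padicValInt p a.num : ℤ) + 2 * (padicValNat p a.den : ℤ)) - 3 * (padicValNat p a.den : ℤ) := by ring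
  rw [this]
  exact dvd_sub h3' (dvd_mul_right 3 _)

/-! ## §4. At `3`: the decomposition group fixing a cube root of `a` forces `3 ∣ ord₃(a)` -/

/-- **Cube roots in `ℚ₃`.** Let `v` be the place of `ℚ` at `3`, `a ∈ ℚˣ`, `α ∈ ℚ̄` with `α³ = a`. If the decomposition
group `GreenbergSelmer.decomp v ≤ Γ_ℚ` (the image of `Γ_{ℚ₃}` along the chosen embedding `ι : ℚ̄ → ℚ̄₃`) fixes `α`,
then `3 ∣ ord₃(a)`: `ι α` is `Γ_{ℚ₃}`-fixed (`absGaloisRestrict_apply_smul`), so lies in `ℚ₃`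
(`absoluteGaloisGroup.exists_algebraMap_eq_pow_of_forall_smul_eq`, characteristic `0`), `a = y³` in `ℚ₃`, and
`v₃(a) = 3 v₃(y)`. [folklore] [cite: SilvermanAEC2009, VIII §2 (local triviality of Kummer classes)] -/
theorem three_dvd_padicValRat_three_of_forall_decomp_smul_eq
    {v : HeightOneSpectrum (𝓞 ℚ)} (hv : natGenerator v = 3)
    {a : ℚ} (ha : a ≠ 0) {α : AlgebraicClosure ℚ} (hα : α ^ 3 = (a : AlgebraicClosure ℚ))
    (hD : ∀ δ ∈ GreenbergSelmer.decomp (K := ℚ) v, δ • α = α) :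
    (3 : ℤ) ∣ padicValRat 3 a := by
  -- `ι α` is fixed by `Γ_{ℚ₃}`
  have hfix : ∀ σ : absoluteGaloisGroup (v.adicCompletion ℚ),
      σ • absClosureEmbedding ℚ (v.adicCompletion ℚ) α = absClosureEmbedding ℚ (v.adicCompletion ℚ) α := by
    intro σ
    have hmem := (GreenbergSelmer.mem_decomp_iff (K := ℚ) v _).mpr ⟨σ, rfl⟩
    rw [← absGaloisRestrict_apply_smul, hD _ hmem]
  -- hence lies in `ℚ₃` (characteristic `0`: exponential characteristic `1`)
  haveI : ExpChar (v.adicCompletion ℚ) 1 := by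
    haveI : CharZero (v.adicCompletion ℚ) :=
      charZero_of_injective_algebraMap (algebraMap ℚ (v.adicCompletion ℚ)).injective
    infer_instance
  obtain ⟨m, y, hy⟩ :=
    absoluteGaloisGroup.exists_algebraMap_eq_pow_of_forall_smul_eq (v.adicCompletion ℚ) 1 hfix
  rw [one_pow, pow_one] at hy
  -- `y³ = a` in `ℚ₃`
  have hy3 : y ^ 3 = algebraMap ℚ (v.adicCompletion ℚ) a := by
    apply (algebraMap (v.adicCompletion ℚ) (AlgebraicClosure (v.adicCompletion ℚ))).injective
    rw [map_pow, hy, ← map_pow, hα, ← IsScalarTower.algebraMap_apply,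
      ← (absClosureEmbedding ℚ (v.adicCompletion ℚ)).commutes a]
    congr 1
  -- valuations
  have hva : Valued.v (algebraMap ℚ (v.adicCompletion ℚ) a) = exp (-padicValRat 3 a) := by
    rw [HeightOneSpectrum.algebraMap_adicCompletion, Function.comp_apply,
      HeightOneSpectrum.valuedAdicCompletion_eq_valuation', Algebra.algebraMap_self_apply,
      valuation_ringOfIntegers_eq_exp_neg_padicValRat v ha, hv]
  have ha' : algebraMap ℚ (v.adicCompletion ℚ) a ≠ 0 := (map_ne_zero _).mpr ha
  have hy0 : y ≠ 0 := by
    intro h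
    rw [h, zero_pow (by norm_num)] at hy3
    exact ha' hy3.symm
  have hvy0 : Valued.v y ≠ 0 := (Valuation.ne_zero_iff _).mpr hy0
  obtain ⟨t, ht⟩ : ∃ t : ℤ, Valued.v y = exp t := ⟨log (Valued.v y), (exp_log hvy0).symm⟩
  have h1 : exp (3 * t) = exp (-padicValRat 3 a) := by
    rw [← hva, ← hy3, map_pow, ht, ← exp_nsmul]
    simp
  have h2 : 3 * t = -padicValRat 3 a := exp_injective h1
  exact ⟨-t, by linarith⟩

/-! ## §5. Assembly: a cube root fixed by inertia away from `3` and by `D₃` is the cube root of a rational cube -/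

/-- **A rational number with a cube root `α ∈ ℚ̄` that is fixed by one inertia group above every prime `p ≠ 3` and by the
decomposition group at `3` is a cube in `ℚ`** (§3 at `p ≠ 3`, §4 at `3`, §2 to conclude). This is the arithmetic of the
Kummer splitting lemma for `0 → 𝟙 → X → μ₃ → 0` over `Γ_ℚ` (sibling file `…FullDescentKummerSplitting`): the local
hypotheses «`I_𝔓` trivial on `X`» and «`X` is `D₃`-split» say exactly that the Kummer generator `α` is so fixed.
[cite: SilvermanAEC2009, Prop. VIII.1.6 (proof), VIII §2] [cite: Serre1972, §1.3 Prop. 1–2] -/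
theorem exists_pow_three_eq_of_forall_inertia_of_decomp {a : ℚ} (ha : a ≠ 0) {α : AlgebraicClosure ℚ}
    (hα : α ^ 3 = (a : AlgebraicClosure ℚ))
    (hI : ∀ v : HeightOneSpectrum (𝓞 ℚ), natGenerator v ≠ 3 →
      ∃ 𝔓 ∈ v.primesAbove, ∀ τ ∈ 𝔓.inertia (absoluteGaloisGroup ℚ), τ • α = α)
    {v₃ : HeightOneSpectrum (𝓞 ℚ)} (hv₃ : natGenerator v₃ = 3)
    (hD : ∀ δ ∈ GreenbergSelmer.decomp (K := ℚ) v₃, δ • α = α) :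
    ∃ r : ℚ, r ^ 3 = a := by
  refine exists_pow_three_eq_of_forall_dvd_padicValRat ha fun p hp ↦ ?_
  by_cases hp3 : p = 3
  · subst hp3
    exact three_dvd_padicValRat_three_of_forall_decomp_smul_eq hv₃ ha hα hD
  · set v : HeightOneSpectrum (𝓞 ℚ) := (primesEquiv (R := 𝓞 ℚ)).symm ⟨p, hp⟩ with hvdef
    have hv : natGenerator v = p := by
      have := congrArg Subtype.val ((primesEquiv (R := 𝓞 ℚ)).apply_symm_apply ⟨p, hp⟩)
      exact this
    obtain ⟨𝔓, h𝔓, hI𝔓⟩ := hI v (by rw [hv]; exact hp3)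
    exact three_dvd_padicValRat_of_forall_inertia_smul_eq hp hp3 hv h𝔓 ha hα hI𝔓

end Summit.BirchSwinnertonDyer.BirchSwinnertonDyer.Theorems.FullDescentKummerArithmetic

end
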